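import Summits.Ventures.LatticeQCDFlow.Scaling.HubChainStartContentDeficitBudget
import Summits.Ventures.LatticeQCDFlow.Scaling.HubChainStartContentCoverShallow

/-!
HONEST FRAMING: exact (Metropolis-corrected) sampling algorithms for lattice gauge theory; figures
of merit are autocorrelation/cost numbers at stated couplings and volumes; no continuum-physics
claim.

# HubChainStartContentDeficitAbove — THE START-CLASS DEFICIT IN THE FOURTH CONFIGURATION (Z10's: START CLASS ALONE AT RANK 0, TAG ALONE AT RANK 1, `cM_0 = 1 + c`): THE RECURSION RUNS
# ON THE TAG'S WEIGHTED DIAGONAL `d_n = r_Y·P_Yⁿ(1,1) − r_X·P_Xⁿ(1,1)` (`r = cρ_0/ρ_1 = −β_1`): `e_{n+1} = d_n + (β_Y^{n+1} − β_X^{n+1}) − gaps`, `d_{n+1} ≤ c·d_n − (β_Y^{n+2} − β_X^{n+2})`, HENCE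
# `e_{n+1} ≤ c^{n+1}(g_n(t_X) − g_n(t_Y))`, `t = ρ_0/ρ_1`: NO DEFICIT AT EVEN STEPS, `e_{n+1} ≤ c^{n+1}·t_Y/(1+t_Y)` AT ODD STEPS `n+1 ≥ 3` (lean-2 GEN-41, ours)

Venture-side (OURS).  Cell `lqcd-flow` (pub-lqcd), unit `pub-lqcd-lean-2-g41`, 2026-08-30.  Chapter AA (route (β), the cost side), file 9 — the last local configuration (Z10's):
the start class `z` alone at rank `0` (the most persistent content), the tag alone at rank `1`, everything else deeper, `cM_0 = 1 + c`.  There `P(0,0) = 0`, every column entry into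
rank `0` agrees except the tag's, and `P_Xⁿ(0,1) = P_Xⁿ(1,1) − (β^X_1)ⁿ` (Y8) with `β_1 = −r`, `r = cρ_0/ρ_1` (`r_X ≥ r_Y`; `t := r/c = ρ_0/ρ_1 ≤ 1`, for the star `t_Y = W_b/W_z`):
`above_levels`; **`above_deficit_succ`** (exact): `e_{n+1} = d_n + ((β^Y_1)^{n+1} − (β^X_1)^{n+1}) − Σ_{l≥2}(P_Xⁿ(0,l)−P_Yⁿ(0,l))·cρ_0/ρ_l`, `d_n = r_YP_Yⁿ(1,1) − r_XP_Xⁿ(1,1)`;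
**`above_tag_succ_le`**: `d_{n+1} ≤ c·d_n − ((β^Y_1)^{n+2} − (β^X_1)^{n+2})` (the tag row: `c·P_Xⁿ(1,0) = r_X(P_Xⁿ(1,1) − (β^X_1)ⁿ)`; the deep columns carry the COMMON factor
`r_Xρ^X_1 = cρ_0` and the deep targets from the tag are dominated, Z2 `perStep_T_le_deep`); **`above_tag_le_g`**, **`above_deficit_le_g`**: `e_{n+1} ≤ c^{n+1}(g_n(t_X) − g_n(t_Y))`
(file 2's `g`); **`above_deficit_even_step`** (`≤ 0`, odd `n`), **`above_deficit_odd_step`** (`≤ c^{n+1}t_Y/(1+t_Y)`, even `n`; for the star `K^{−(n+1)}W_b/(W_z+W_b)` — the mirror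
image of file 2, parity flipped: toy `numerics41/b1check.py`); **`above_deficit_discounted`**: `Σ_{n<J}(1−σ)σⁿe⁺_{n+1} ≤ (1−σ)(t_Y/(1+t_Y))·c·(σc)²/(1−(σc)²)` (no deficit before the
third attempt).  With files 1–3 and Z2 every local configuration has an explicit geometric deficit budget.  Literature grade: OWN, elementary; nothing cited; no new bib keys. -/

open Finset

namespace Summit.Ventures.LatticeQCDFlow.Scaling

section Above
variable {m : ℕ} {ρX ρY N RX RY M βX βY a : ℕ → ℝ} {c : ℝ} {PX PY fX fY : ℕ → ℕ → ℝ} {PnX PnY : ℕ → ℕ → ℕ → ℝ} {TX TY : ℕ → ℕ → ℝ}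

/-- The kernel entries at ranks `0, 1` in this configuration (one profile): `P(0,0) = 0`, `P(0,1) = c`, `P(1,0) = cρ_0/ρ_1`, `P(1,1) = c − cρ_0/ρ_1`, `β_1 = −cρ_0/ρ_1`,
and for `l ≥ 2`: `P(l,0) = cρ_0/ρ_l`, `P(l,1) = cρ_1/ρ_l`. [ours] -/
theorem above_levels (hρ : ∀ i, 0 < ρX i) (hmono : Monotone ρX)
    (hRX : ∀ k, RX k = ∑ i ∈ range k, N i * ρX i) (hM : ∀ k, M k = ∑ i ∈ Ico k m, N i)
    (hPXoff : ∀ i j, i ≠ j → PX i j = c * N j * min 1 (ρX j / ρX i)) (hPXdiag : ∀ i, PX i i = 1 - ∑ j ∈ (range m).erase i, PX i j)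
    (hβX : ∀ k, βX k = 1 - c * (M k + RX k / ρX k)) (ha : ∀ l, a l = 1 - c * M (l + 1))
    (hcK : c * M 0 = 1 + c) (hN0 : N 0 = 1) (hN1 : N 1 = 1) (hm : 1 < m) (hc : 0 ≤ c) :
    PX 0 0 = 0 ∧ PX 0 1 = c ∧ PX 1 0 = c * ρX 0 / ρX 1 ∧ PX 1 1 = c - c * ρX 0 / ρX 1 ∧ βX 1 = -(c * ρX 0 / ρX 1)
      ∧ (∀ l, 2 ≤ l → PX l 0 = c * ρX 0 / ρX l ∧ PX l 1 = c * ρX 1 / ρX l) := by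
  obtain ⟨-, -, hb0, hb1, -⟩ := coverC_levels hρ hmono hRX hM hβX ha hcK hN0 hN1 hm hc
  have hd0 : PX 0 0 = βX 0 + c * N 0 := hubClass_diag hρ hmono hRX hM hPXoff hPXdiag hβX (by omega)
  have hd1 : PX 1 1 = βX 1 + c * N 1 := hubClass_diag hρ hmono hRX hM hPXoff hPXdiag hβX hm
  refine ⟨by rw [hd0, hb0, hN0]; ring, ?_, ?_, by rw [hd1, hb1, hN1]; ring, hb1, fun l hl => ⟨?_, ?_⟩⟩
  · rw [hPXoff 0 1 (by omega), hN1, min_eq_left ((one_le_div (hρ 0)).mpr (hmono (by omega)))]; ring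
  · rw [hPXoff 1 0 (by omega), hN0, min_eq_right ((div_le_one (hρ 1)).mpr (hmono (by omega)))]; ring
  · rw [hPXoff l 0 (by omega), hN0, min_eq_right ((div_le_one (hρ l)).mpr (hmono (by omega)))]; ring
  · rw [hPXoff l 1 (by omega), hN1, min_eq_right ((div_le_one (hρ l)).mpr (hmono (by omega)))]; ring

/-- **THE EXACT RECURSION FOR THE START CLASS ABOVE THE TAG:** `e_{n+1} = d_n + ((β^Y_1)^{n+1} − (β^X_1)^{n+1}) − Σ_{l≥2}(P_Xⁿ(0,l) − P_Yⁿ(0,l))·(cρ_0/ρ_l)`,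
`d_n = (cρ_0/ρ^Y_1)P_Yⁿ(1,1) − (cρ_0/ρ^X_1)P_Xⁿ(1,1)`. [ours] -/
theorem above_deficit_succ (hρX : ∀ i, 0 < ρX i) (hmonoX : Monotone ρX) (hρY : ∀ i, 0 < ρY i) (hmonoY : Monotone ρY)
    (hagree : ∀ i, i ≠ 1 → ρX i = ρY i) (hN : ∀ i, 0 < N i)
    (hRX : ∀ k, RX k = ∑ i ∈ range k, N i * ρX i) (hRY : ∀ k, RY k = ∑ i ∈ range k, N i * ρY i) (hM : ∀ k, M k = ∑ i ∈ Ico k m, N i)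
    (hPXoff : ∀ i j, i ≠ j → PX i j = c * N j * min 1 (ρX j / ρX i)) (hPXdiag : ∀ i, PX i i = 1 - ∑ j ∈ (range m).erase i, PX i j)
    (hPYoff : ∀ i j, i ≠ j → PY i j = c * N j * min 1 (ρY j / ρY i)) (hPYdiag : ∀ i, PY i i = 1 - ∑ j ∈ (range m).erase i, PY i j)
    (hfX : ∀ k i, fX k i = if i < k then ρX k else if i = k then -(RX k / N k) else 0)
    (hfY : ∀ k i, fY k i = if i < k then ρY k else if i = k then -(RY k / N k) else 0)
    (hβX : ∀ k, βX k = 1 - c * (M k + RX k / ρX k)) (hβY : ∀ k, βY k = 1 - c * (M k + RY k / ρY k)) (ha : ∀ l, a l = 1 - c * M (l + 1))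
    (hPX0 : ∀ i j, PnX 0 i j = if i = j then 1 else 0) (hPXs : ∀ n i j, PnX (n + 1) i j = ∑ l ∈ range m, PnX n i l * PX l j)
    (hPY0 : ∀ i j, PnY 0 i j = if i = j then 1 else 0) (hPYs : ∀ n i j, PnY (n + 1) i j = ∑ l ∈ range m, PnY n i l * PY l j)
    (hTX : ∀ n j, TX n j = (1 - βX j ^ n) / RX m + ∑ k ∈ Ico (j + 1) m, (1 / RX k - 1 / RX (k + 1)) * (βX k ^ n - βX j ^ n))
    (hTY : ∀ n j, TY n j = (1 - βY j ^ n) / RY m + ∑ k ∈ Ico (j + 1) m, (1 / RY k - 1 / RY (k + 1)) * (βY k ^ n - βY j ^ n))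
    (hc : 0 ≤ c) (hcK : c * M 0 = 1 + c) (hN0 : N 0 = 1) (hN1 : N 1 = 1) (hm : 1 < m) (n : ℕ) :
    PnY (n + 1) 0 0 - PnX (n + 1) 0 0
      = (c * ρX 0 / ρY 1 * PnY n 1 1 - c * ρX 0 / ρX 1 * PnX n 1 1) + (βY 1 ^ (n + 1) - βX 1 ^ (n + 1))
        - ∑ l ∈ ((range m).erase 0).erase 1, (PnX n 0 l - PnY n 0 l) * (c * ρX 0 / ρX l) := by
  have h0 : (0 : ℕ) < m := by omega
  have hρ0 : ρY 0 = ρX 0 := (hagree 0 (by omega)).symm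
  obtain ⟨hX00, -, hX10, -, hbX, hXl⟩ := above_levels hρX hmonoX hRX hM hPXoff hPXdiag hβX ha hcK hN0 hN1 hm hc
  obtain ⟨hY00, -, hY10, -, hbY, hYl⟩ := above_levels hρY hmonoY hRY hM hPYoff hPYdiag hβY ha hcK hN0 hN1 hm hc
  rw [hρ0] at hY10 hbY hYl
  have split : ∀ (g : ℕ → ℝ), ∑ l ∈ range m, g l = g 0 + g 1 + ∑ l ∈ ((range m).erase 0).erase 1, g l := fun g => by
    rw [← add_sum_erase _ _ (mem_range.mpr h0), ← add_sum_erase _ _ (mem_erase.mpr ⟨by omega, mem_range.mpr hm⟩ : (1 : ℕ) ∈ (range m).erase 0)]; ring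
  rw [hPYs n 0 0, hPXs n 0 0, split, split, hX00, hY00, hX10, hY10]
  have hX01 := hubClass_pow_offdiag hρX hmonoX hN hRX hM hPXoff hPXdiag hfX hβX hPX0 hPXs hTX n h0 hm zero_ne_one
  have hY01 := hubClass_pow_offdiag hρY hmonoY hN hRY hM hPYoff hPYdiag hfY hβY hPY0 hPYs hTY n h0 hm zero_ne_one
  rw [max_eq_right zero_le_one] at hX01 hY01
  have hX11 := hubClass_pow_diag hρX hmonoX hN hRX hM hPXoff hPXdiag hfX hβX hPX0 hPXs hTX n hm
  have hY11 := hubClass_pow_diag hρY hmonoY hN hRY hM hPYoff hPYdiag hfY hβY hPY0 hPYs hTY n hm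
  rw [hN1] at hX01 hY01 hX11 hY11
  have eX : PnX n 0 1 = PnX n 1 1 - βX 1 ^ n := by rw [hX01, hX11]; ring
  have eY : PnY n 0 1 = PnY n 1 1 - βY 1 ^ n := by rw [hY01, hY11]; ring
  have hrest : ∑ l ∈ ((range m).erase 0).erase 1, PnY n 0 l * PY l 0 - ∑ l ∈ ((range m).erase 0).erase 1, PnX n 0 l * PX l 0
      = -(∑ l ∈ ((range m).erase 0).erase 1, (PnX n 0 l - PnY n 0 l) * (c * ρX 0 / ρX l)) := by
    rw [← sum_sub_distrib, ← sum_neg_distrib]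
    refine sum_congr rfl fun l hl => ?_
    have hl1 : l ≠ 1 := ne_of_mem_erase hl; have hl0 : l ≠ 0 := ne_of_mem_erase (mem_of_mem_erase hl); have hl2 : 2 ≤ l := by omega
    rw [(hXl l hl2).1, (hYl l hl2).1, ← hagree l hl1]; ring
  have hρX1 := (hρX 1).ne'; have hρY1 := (hρY 1).ne'
  have epowX : c * ρX 0 / ρX 1 * βX 1 ^ n = -(βX 1 ^ (n + 1)) := by rw [pow_succ, hbX]; ring
  have epowY : c * ρX 0 / ρY 1 * βY 1 ^ n = -(βY 1 ^ (n + 1)) := by rw [pow_succ, hbY]; ring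
  calc PnY n 0 0 * 0 + PnY n 0 1 * (c * ρX 0 / ρY 1) + ∑ l ∈ ((range m).erase 0).erase 1, PnY n 0 l * PY l 0
        - (PnX n 0 0 * 0 + PnX n 0 1 * (c * ρX 0 / ρX 1) + ∑ l ∈ ((range m).erase 0).erase 1, PnX n 0 l * PX l 0)
      = (c * ρX 0 / ρY 1 * PnY n 1 1 - c * ρX 0 / ρX 1 * PnX n 1 1) - (c * ρX 0 / ρY 1 * βY 1 ^ n - c * ρX 0 / ρX 1 * βX 1 ^ n)
        + (∑ l ∈ ((range m).erase 0).erase 1, PnY n 0 l * PY l 0 - ∑ l ∈ ((range m).erase 0).erase 1, PnX n 0 l * PX l 0) := by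
          rw [eX, eY]; ring
    _ = _ := by rw [hrest, epowX, epowY]; ring

/-- **The tag's weighted diagonal:** `d_{n+1} ≤ c·d_n − ((β^Y_1)^{n+2} − (β^X_1)^{n+2})` (every class weight `≥ 1`). [ours] -/
theorem above_tag_succ_le (hρX : ∀ i, 0 < ρX i) (hmonoX : Monotone ρX) (hρY : ∀ i, 0 < ρY i) (hmonoY : Monotone ρY)
    (hagree : ∀ i, i ≠ 1 → ρX i = ρY i) (htag : ρX 1 ≤ ρY 1) (hN : ∀ i, 0 < N i) (hNge : ∀ i, 1 ≤ N i)
    (hRX : ∀ k, RX k = ∑ i ∈ range k, N i * ρX i) (hRY : ∀ k, RY k = ∑ i ∈ range k, N i * ρY i) (hM : ∀ k, M k = ∑ i ∈ Ico k m, N i)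
    (hPXoff : ∀ i j, i ≠ j → PX i j = c * N j * min 1 (ρX j / ρX i)) (hPXdiag : ∀ i, PX i i = 1 - ∑ j ∈ (range m).erase i, PX i j)
    (hPYoff : ∀ i j, i ≠ j → PY i j = c * N j * min 1 (ρY j / ρY i)) (hPYdiag : ∀ i, PY i i = 1 - ∑ j ∈ (range m).erase i, PY i j)
    (hfX : ∀ k i, fX k i = if i < k then ρX k else if i = k then -(RX k / N k) else 0)
    (hfY : ∀ k i, fY k i = if i < k then ρY k else if i = k then -(RY k / N k) else 0)
    (hβX : ∀ k, βX k = 1 - c * (M k + RX k / ρX k)) (hβY : ∀ k, βY k = 1 - c * (M k + RY k / ρY k)) (ha : ∀ l, a l = 1 - c * M (l + 1))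
    (hPX0 : ∀ i j, PnX 0 i j = if i = j then 1 else 0) (hPXs : ∀ n i j, PnX (n + 1) i j = ∑ l ∈ range m, PnX n i l * PX l j)
    (hPY0 : ∀ i j, PnY 0 i j = if i = j then 1 else 0) (hPYs : ∀ n i j, PnY (n + 1) i j = ∑ l ∈ range m, PnY n i l * PY l j)
    (hTX : ∀ n j, TX n j = (1 - βX j ^ n) / RX m + ∑ k ∈ Ico (j + 1) m, (1 / RX k - 1 / RX (k + 1)) * (βX k ^ n - βX j ^ n))
    (hTY : ∀ n j, TY n j = (1 - βY j ^ n) / RY m + ∑ k ∈ Ico (j + 1) m, (1 / RY k - 1 / RY (k + 1)) * (βY k ^ n - βY j ^ n))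
    (hc : 0 ≤ c) (hcK : c * M 0 = 1 + c) (hN0 : N 0 = 1) (hN1 : N 1 = 1) (hm : 1 < m) (n : ℕ) :
    (c * ρX 0 / ρY 1 * PnY (n + 1) 1 1 - c * ρX 0 / ρX 1 * PnX (n + 1) 1 1)
      ≤ c * (c * ρX 0 / ρY 1 * PnY n 1 1 - c * ρX 0 / ρX 1 * PnX n 1 1) - (βY 1 ^ (n + 2) - βX 1 ^ (n + 2)) := by
  have h0 : (0 : ℕ) < m := by omega
  have hρ0 : ρY 0 = ρX 0 := (hagree 0 (by omega)).symm
  obtain ⟨-, hX01k, -, hX11k, hbX, hXl⟩ := above_levels hρX hmonoX hRX hM hPXoff hPXdiag hβX ha hcK hN0 hN1 hm hc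
  obtain ⟨-, hY01k, -, hY11k, hbY, hYl⟩ := above_levels hρY hmonoY hRY hM hPYoff hPYdiag hβY ha hcK hN0 hN1 hm hc
  rw [hρ0] at hY11k hbY hYl
  have split : ∀ (g : ℕ → ℝ), ∑ l ∈ range m, g l = g 0 + g 1 + ∑ l ∈ ((range m).erase 0).erase 1, g l := fun g => by
    rw [← add_sum_erase _ _ (mem_range.mpr h0), ← add_sum_erase _ _ (mem_erase.mpr ⟨by omega, mem_range.mpr hm⟩ : (1 : ℕ) ∈ (range m).erase 0)]; ring
  have hX10 := hubClass_pow_offdiag hρX hmonoX hN hRX hM hPXoff hPXdiag hfX hβX hPX0 hPXs hTX n hm h0 one_ne_zero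
  have hY10 := hubClass_pow_offdiag hρY hmonoY hN hRY hM hPYoff hPYdiag hfY hβY hPY0 hPYs hTY n hm h0 one_ne_zero
  rw [max_eq_left zero_le_one, hN0] at hX10 hY10
  have hX11 := hubClass_pow_diag hρX hmonoX hN hRX hM hPXoff hPXdiag hfX hβX hPX0 hPXs hTX n hm
  have hY11 := hubClass_pow_diag hρY hmonoY hN hRY hM hPYoff hPYdiag hfY hβY hPY0 hPYs hTY n hm
  rw [hN1] at hX11 hY11
  rw [hρ0] at hY10
  have hρX1 := (hρX 1).ne'; have hρY1 := (hρY 1).ne'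
  have eX : c * PnX n 1 0 = c * ρX 0 / ρX 1 * (PnX n 1 1 - βX 1 ^ n) := by rw [hX10, hX11]; field_simp; ring
  have eY : c * PnY n 1 0 = c * ρX 0 / ρY 1 * (PnY n 1 1 - βY 1 ^ n) := by rw [hY10, hY11]; field_simp; ring
  have hdeep : c * ρX 0 / ρY 1 * ∑ l ∈ ((range m).erase 0).erase 1, PnY n 1 l * PY l 1
      ≤ c * ρX 0 / ρX 1 * ∑ l ∈ ((range m).erase 0).erase 1, PnX n 1 l * PX l 1 := by
    rw [mul_sum, mul_sum]
    refine sum_le_sum fun l hl => ?_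
    have hl1 : l ≠ 1 := ne_of_mem_erase hl; have hl' := mem_of_mem_erase hl; have hl0 : l ≠ 0 := ne_of_mem_erase hl'
    have hlm : l < m := mem_range.mp (mem_of_mem_erase hl'); have hl2 : 2 ≤ l := by omega
    rw [(hXl l hl2).2, (hYl l hl2).2, ← hagree l hl1,
      hubClass_pow_offdiag hρX hmonoX hN hRX hM hPXoff hPXdiag hfX hβX hPX0 hPXs hTX n hm hlm hl1.symm,
      hubClass_pow_offdiag hρY hmonoY hN hRY hM hPYoff hPYdiag hfY hβY hPY0 hPYs hTY n hm hlm hl1.symm, max_eq_right (by omega : 1 ≤ l), ← hagree l hl1]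
    have h3 : M (l + 1) + 3 ≤ M 0 := by
      have hM0 : M 0 = N 0 + M 1 := hubClass_M_succ hM h0
      have hM1 : M 1 = N 1 + M 2 := hubClass_M_succ hM hm
      have hMl : M l = N l + M (l + 1) := hubClass_M_succ hM hlm
      have hM2l : M l ≤ M 2 := perStep_M_anti hN hM hl2
      have := hNge l
      rw [hN0] at hM0; rw [hN1] at hM1
      linarith
    have hT := perStep_T_le_deep hρX hρY hmonoY hagree htag hN hRX hRY hM hβX hβY ha hTX hTY hc hcK.le n (by omega : 1 < l) hlm h3
    have hρl := hρX l
    have e1 : c * ρX 0 / ρY 1 * (N l * ρY l * TY n l * (c * ρY 1 / ρX l)) = c * c * ρX 0 * N l * (ρY l / ρX l) * TY n l := by field_simp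
    have e2 : c * ρX 0 / ρX 1 * (N l * ρX l * TX n l * (c * ρX 1 / ρX l)) = c * c * ρX 0 * N l * (ρX l / ρX l) * TX n l := by field_simp
    rw [← hagree l hl1] at e1
    rw [e1, e2]
    exact mul_le_mul_of_nonneg_left hT (by
      have : 0 ≤ ρX l / ρX l := div_nonneg hρl.le hρl.le
      have := mul_nonneg (mul_nonneg (mul_nonneg (mul_nonneg hc hc) (hρX 0).le) (hN l).le) this
      exact this)
  rw [hPYs n 1 1, hPXs n 1 1, split, split, hX01k, hY01k, hX11k, hY11k]
  have epX : c * ρX 0 / ρX 1 * (c * ρX 0 / ρX 1) * βX 1 ^ n = βX 1 ^ (n + 2) := by rw [pow_succ, pow_succ, hbX]; ring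
  have epY : c * ρX 0 / ρY 1 * (c * ρX 0 / ρY 1) * βY 1 ^ n = βY 1 ^ (n + 2) := by rw [pow_succ, pow_succ, hbY]; ring
  have kX : c * ρX 0 / ρX 1 * (PnX n 1 0 * c + PnX n 1 1 * (c - c * ρX 0 / ρX 1))
      = c * (c * ρX 0 / ρX 1 * PnX n 1 1) - βX 1 ^ (n + 2) := by
    have : c * ρX 0 / ρX 1 * (PnX n 1 0 * c) = c * ρX 0 / ρX 1 * (c * ρX 0 / ρX 1 * (PnX n 1 1 - βX 1 ^ n)) := by rw [← eX]; ring
    rw [mul_add, this, ← epX]; ring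
  have kY : c * ρX 0 / ρY 1 * (PnY n 1 0 * c + PnY n 1 1 * (c - c * ρX 0 / ρY 1))
      = c * (c * ρX 0 / ρY 1 * PnY n 1 1) - βY 1 ^ (n + 2) := by
    have : c * ρX 0 / ρY 1 * (PnY n 1 0 * c) = c * ρX 0 / ρY 1 * (c * ρX 0 / ρY 1 * (PnY n 1 1 - βY 1 ^ n)) := by rw [← eY]; ring
    rw [mul_add, this, ← epY]; ring
  have eLY : c * ρX 0 / ρY 1 * (PnY n 1 0 * c + PnY n 1 1 * (c - c * ρX 0 / ρY 1) + ∑ l ∈ ((range m).erase 0).erase 1, PnY n 1 l * PY l 1)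
      = (c * (c * ρX 0 / ρY 1 * PnY n 1 1) - βY 1 ^ (n + 2)) + c * ρX 0 / ρY 1 * ∑ l ∈ ((range m).erase 0).erase 1, PnY n 1 l * PY l 1 := by
    rw [mul_add, kY]
  have eLX : c * ρX 0 / ρX 1 * (PnX n 1 0 * c + PnX n 1 1 * (c - c * ρX 0 / ρX 1) + ∑ l ∈ ((range m).erase 0).erase 1, PnX n 1 l * PX l 1)
      = (c * (c * ρX 0 / ρX 1 * PnX n 1 1) - βX 1 ^ (n + 2)) + c * ρX 0 / ρX 1 * ∑ l ∈ ((range m).erase 0).erase 1, PnX n 1 l * PX l 1 := by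
    rw [mul_add, kX]
  rw [eLY, eLX]
  linarith [hdeep]

/-- **`d_n ≤ −c^{n+1}·(g_{n+1}(t_Y) − g_{n+1}(t_X))`** with file 2's `g` and `t = ρ_0/ρ_1`. [ours] -/
theorem above_tag_le_g (hρX : ∀ i, 0 < ρX i) (hmonoX : Monotone ρX) (hρY : ∀ i, 0 < ρY i) (hmonoY : Monotone ρY)
    (hagree : ∀ i, i ≠ 1 → ρX i = ρY i) (htag : ρX 1 ≤ ρY 1) (hN : ∀ i, 0 < N i) (hNge : ∀ i, 1 ≤ N i)
    (hRX : ∀ k, RX k = ∑ i ∈ range k, N i * ρX i) (hRY : ∀ k, RY k = ∑ i ∈ range k, N i * ρY i) (hM : ∀ k, M k = ∑ i ∈ Ico k m, N i)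
    (hPXoff : ∀ i j, i ≠ j → PX i j = c * N j * min 1 (ρX j / ρX i)) (hPXdiag : ∀ i, PX i i = 1 - ∑ j ∈ (range m).erase i, PX i j)
    (hPYoff : ∀ i j, i ≠ j → PY i j = c * N j * min 1 (ρY j / ρY i)) (hPYdiag : ∀ i, PY i i = 1 - ∑ j ∈ (range m).erase i, PY i j)
    (hfX : ∀ k i, fX k i = if i < k then ρX k else if i = k then -(RX k / N k) else 0)
    (hfY : ∀ k i, fY k i = if i < k then ρY k else if i = k then -(RY k / N k) else 0)
    (hβX : ∀ k, βX k = 1 - c * (M k + RX k / ρX k)) (hβY : ∀ k, βY k = 1 - c * (M k + RY k / ρY k)) (ha : ∀ l, a l = 1 - c * M (l + 1))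
    (hPX0 : ∀ i j, PnX 0 i j = if i = j then 1 else 0) (hPXs : ∀ n i j, PnX (n + 1) i j = ∑ l ∈ range m, PnX n i l * PX l j)
    (hPY0 : ∀ i j, PnY 0 i j = if i = j then 1 else 0) (hPYs : ∀ n i j, PnY (n + 1) i j = ∑ l ∈ range m, PnY n i l * PY l j)
    (hTX : ∀ n j, TX n j = (1 - βX j ^ n) / RX m + ∑ k ∈ Ico (j + 1) m, (1 / RX k - 1 / RX (k + 1)) * (βX k ^ n - βX j ^ n))
    (hTY : ∀ n j, TY n j = (1 - βY j ^ n) / RY m + ∑ k ∈ Ico (j + 1) m, (1 / RY k - 1 / RY (k + 1)) * (βY k ^ n - βY j ^ n))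
    {g : ℕ → ℝ → ℝ} (hg : ∀ n t, g n t = (-t - (-t) ^ (n + 1)) / (1 + t))
    (hc : 0 ≤ c) (hcK : c * M 0 = 1 + c) (hN0 : N 0 = 1) (hN1 : N 1 = 1) (hm : 1 < m) (n : ℕ) :
    c * ρX 0 / ρY 1 * PnY n 1 1 - c * ρX 0 / ρX 1 * PnX n 1 1 ≤ -(c ^ (n + 1) * (g (n + 1) (ρX 0 / ρY 1) - g (n + 1) (ρX 0 / ρX 1))) := by
  have htX : 0 ≤ ρX 0 / ρX 1 := div_nonneg (hρX 0).le (hρX 1).le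
  have htY : 0 ≤ ρX 0 / ρY 1 := div_nonneg (hρX 0).le (hρY 1).le
  obtain ⟨-, -, -, -, hbX, -⟩ := above_levels hρX hmonoX hRX hM hPXoff hPXdiag hβX ha hcK hN0 hN1 hm hc
  obtain ⟨-, -, -, -, hbY, -⟩ := above_levels hρY hmonoY hRY hM hPYoff hPYdiag hβY ha hcK hN0 hN1 hm hc
  rw [(hagree 0 (by omega)).symm] at hbY
  have hpX : ∀ k, βX 1 ^ k = c ^ k * (-(ρX 0 / ρX 1)) ^ k := fun k => by rw [hbX, ← mul_pow]; congr 1; ring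
  have hpY : ∀ k, βY 1 ^ k = c ^ k * (-(ρX 0 / ρY 1)) ^ k := fun k => by rw [hbY, ← mul_pow]; congr 1; ring
  induction n with
  | zero =>
      rw [hPY0, hPX0, if_pos rfl, residual_g_succ hg 0 htX, residual_g_succ hg 0 htY, residual_g_zero hg htX, residual_g_zero hg htY]
      ring_nf
      linarith
  | succ n ih =>
      have hstep := above_tag_succ_le hρX hmonoX hρY hmonoY hagree htag hN hNge hRX hRY hM hPXoff hPXdiag hPYoff hPYdiag hfX hfY hβX hβY ha hPX0 hPXs hPY0 hPYs hTX hTY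
        hc hcK hN0 hN1 hm n
      rw [residual_g_succ hg (n + 1) htX, residual_g_succ hg (n + 1) htY]
      have hmono : c * (c * ρX 0 / ρY 1 * PnY n 1 1 - c * ρX 0 / ρX 1 * PnX n 1 1) ≤ c * -(c ^ (n + 1) * (g (n + 1) (ρX 0 / ρY 1) - g (n + 1) (ρX 0 / ρX 1))) :=
        mul_le_mul_of_nonneg_left ih hc
      calc c * ρX 0 / ρY 1 * PnY (n + 1) 1 1 - c * ρX 0 / ρX 1 * PnX (n + 1) 1 1
          ≤ c * (c * ρX 0 / ρY 1 * PnY n 1 1 - c * ρX 0 / ρX 1 * PnX n 1 1) - (βY 1 ^ (n + 2) - βX 1 ^ (n + 2)) := hstep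
        _ ≤ c * -(c ^ (n + 1) * (g (n + 1) (ρX 0 / ρY 1) - g (n + 1) (ρX 0 / ρX 1))) - (βY 1 ^ (n + 2) - βX 1 ^ (n + 2)) := by linarith
        _ = -(c ^ (n + 1 + 1) * (g (n + 1) (ρX 0 / ρY 1) + (-(ρX 0 / ρY 1)) ^ (n + 1 + 1) - (g (n + 1) (ρX 0 / ρX 1) + (-(ρX 0 / ρX 1)) ^ (n + 1 + 1)))) := by
            rw [hpX (n + 2), hpY (n + 2), show n + 1 + 1 = n + 2 from rfl, pow_succ]; ring

/-- **`e_{n+1} ≤ c^{n+1}·(g_n(t_X) − g_n(t_Y))`.** [ours] -/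
theorem above_deficit_le_g (hρX : ∀ i, 0 < ρX i) (hmonoX : Monotone ρX) (hρY : ∀ i, 0 < ρY i) (hmonoY : Monotone ρY)
    (hagree : ∀ i, i ≠ 1 → ρX i = ρY i) (htag : ρX 1 ≤ ρY 1) (hN : ∀ i, 0 < N i) (hNge : ∀ i, 1 ≤ N i)
    (hRX : ∀ k, RX k = ∑ i ∈ range k, N i * ρX i) (hRY : ∀ k, RY k = ∑ i ∈ range k, N i * ρY i) (hM : ∀ k, M k = ∑ i ∈ Ico k m, N i)
    (hPXoff : ∀ i j, i ≠ j → PX i j = c * N j * min 1 (ρX j / ρX i)) (hPXdiag : ∀ i, PX i i = 1 - ∑ j ∈ (range m).erase i, PX i j)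
    (hPYoff : ∀ i j, i ≠ j → PY i j = c * N j * min 1 (ρY j / ρY i)) (hPYdiag : ∀ i, PY i i = 1 - ∑ j ∈ (range m).erase i, PY i j)
    (hfX : ∀ k i, fX k i = if i < k then ρX k else if i = k then -(RX k / N k) else 0)
    (hfY : ∀ k i, fY k i = if i < k then ρY k else if i = k then -(RY k / N k) else 0)
    (hβX : ∀ k, βX k = 1 - c * (M k + RX k / ρX k)) (hβY : ∀ k, βY k = 1 - c * (M k + RY k / ρY k)) (ha : ∀ l, a l = 1 - c * M (l + 1))
    (hPX0 : ∀ i j, PnX 0 i j = if i = j then 1 else 0) (hPXs : ∀ n i j, PnX (n + 1) i j = ∑ l ∈ range m, PnX n i l * PX l j)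
    (hPY0 : ∀ i j, PnY 0 i j = if i = j then 1 else 0) (hPYs : ∀ n i j, PnY (n + 1) i j = ∑ l ∈ range m, PnY n i l * PY l j)
    (hTX : ∀ n j, TX n j = (1 - βX j ^ n) / RX m + ∑ k ∈ Ico (j + 1) m, (1 / RX k - 1 / RX (k + 1)) * (βX k ^ n - βX j ^ n))
    (hTY : ∀ n j, TY n j = (1 - βY j ^ n) / RY m + ∑ k ∈ Ico (j + 1) m, (1 / RY k - 1 / RY (k + 1)) * (βY k ^ n - βY j ^ n))
    {g : ℕ → ℝ → ℝ} (hg : ∀ n t, g n t = (-t - (-t) ^ (n + 1)) / (1 + t))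
    (hc : 0 ≤ c) (hcK : c * M 0 = 1 + c) (hN0 : N 0 = 1) (hN1 : N 1 = 1) (hm : 1 < m) (n : ℕ) :
    PnY (n + 1) 0 0 - PnX (n + 1) 0 0 ≤ c ^ (n + 1) * (g n (ρX 0 / ρX 1) - g n (ρX 0 / ρY 1)) := by
  have htX : 0 ≤ ρX 0 / ρX 1 := div_nonneg (hρX 0).le (hρX 1).le
  have htY : 0 ≤ ρX 0 / ρY 1 := div_nonneg (hρX 0).le (hρY 1).le
  obtain ⟨-, -, -, -, hbX, -⟩ := above_levels hρX hmonoX hRX hM hPXoff hPXdiag hβX ha hcK hN0 hN1 hm hc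
  obtain ⟨-, -, -, -, hbY, -⟩ := above_levels hρY hmonoY hRY hM hPYoff hPYdiag hβY ha hcK hN0 hN1 hm hc
  rw [(hagree 0 (by omega)).symm] at hbY
  have hpX : ∀ k, βX 1 ^ k = c ^ k * (-(ρX 0 / ρX 1)) ^ k := fun k => by rw [hbX, ← mul_pow]; congr 1; ring
  have hpY : ∀ k, βY 1 ^ k = c ^ k * (-(ρX 0 / ρY 1)) ^ k := fun k => by rw [hbY, ← mul_pow]; congr 1; ring
  rw [above_deficit_succ hρX hmonoX hρY hmonoY hagree hN hRX hRY hM hPXoff hPXdiag hPYoff hPYdiag hfX hfY hβX hβY ha hPX0 hPXs hPY0 hPYs hTX hTY hc hcK hN0 hN1 hm n]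
  have hd := above_tag_le_g hρX hmonoX hρY hmonoY hagree htag hN hNge hRX hRY hM hPXoff hPXdiag hPYoff hPYdiag hfX hfY hβX hβY ha hPX0 hPXs hPY0 hPYs hTX hTY hg
    hc hcK hN0 hN1 hm n
  have hgap : 0 ≤ ∑ l ∈ ((range m).erase 0).erase 1, (PnX n 0 l - PnY n 0 l) * (c * ρX 0 / ρX l) := by
    refine sum_nonneg fun l hl => ?_
    have hl1 : l ≠ 1 := ne_of_mem_erase hl; have hl' := mem_of_mem_erase hl; have hl0 : l ≠ 0 := ne_of_mem_erase hl'
    have hlm : l < m := mem_range.mp (mem_of_mem_erase hl'); have hl2 : 2 ≤ l := by omega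
    have h3 : M (max (max 0 l) 1 + 1) + 3 ≤ M 0 := by
      rw [show max (max 0 l) 1 = l by omega]
      have hM0 : M 0 = N 0 + M 1 := hubClass_M_succ hM (by omega)
      have hM1 : M 1 = N 1 + M 2 := hubClass_M_succ hM hm
      have hMl : M l = N l + M (l + 1) := hubClass_M_succ hM hlm
      have hM2l : M l ≤ M 2 := perStep_M_anti hN hM hl2
      have := hNge l
      rw [hN0] at hM0; rw [hN1] at hM1
      linarith
    have hdom := perStep_pow_le hρX hmonoX hρY hmonoY hagree htag hN hRX hRY hM hPXoff hPXdiag hPYoff hPYdiag hfX hfY hβX hβY ha hPX0 hPXs hPY0 hPYs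
      hTX hTY hc hcK.le n (by omega) hlm hm (Ne.symm hl0) zero_ne_one hl1 h3
    exact mul_nonneg (by linarith) (div_nonneg (mul_nonneg hc (hρX 0).le) (hρX l).le)
  rw [residual_g_succ hg n htX, residual_g_succ hg n htY] at hd
  rw [hpX (n + 1), hpY (n + 1)]
  nlinarith [hd, hgap]

/-- **NO DEFICIT AT EVEN STEPS** (`n` odd) for the start class above the tag. [ours] -/
theorem above_deficit_even_step (hρX : ∀ i, 0 < ρX i) (hmonoX : Monotone ρX) (hρY : ∀ i, 0 < ρY i) (hmonoY : Monotone ρY)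
    (hagree : ∀ i, i ≠ 1 → ρX i = ρY i) (htag : ρX 1 ≤ ρY 1) (hN : ∀ i, 0 < N i) (hNge : ∀ i, 1 ≤ N i)
    (hRX : ∀ k, RX k = ∑ i ∈ range k, N i * ρX i) (hRY : ∀ k, RY k = ∑ i ∈ range k, N i * ρY i) (hM : ∀ k, M k = ∑ i ∈ Ico k m, N i)
    (hPXoff : ∀ i j, i ≠ j → PX i j = c * N j * min 1 (ρX j / ρX i)) (hPXdiag : ∀ i, PX i i = 1 - ∑ j ∈ (range m).erase i, PX i j)
    (hPYoff : ∀ i j, i ≠ j → PY i j = c * N j * min 1 (ρY j / ρY i)) (hPYdiag : ∀ i, PY i i = 1 - ∑ j ∈ (range m).erase i, PY i j)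
    (hfX : ∀ k i, fX k i = if i < k then ρX k else if i = k then -(RX k / N k) else 0)
    (hfY : ∀ k i, fY k i = if i < k then ρY k else if i = k then -(RY k / N k) else 0)
    (hβX : ∀ k, βX k = 1 - c * (M k + RX k / ρX k)) (hβY : ∀ k, βY k = 1 - c * (M k + RY k / ρY k)) (ha : ∀ l, a l = 1 - c * M (l + 1))
    (hPX0 : ∀ i j, PnX 0 i j = if i = j then 1 else 0) (hPXs : ∀ n i j, PnX (n + 1) i j = ∑ l ∈ range m, PnX n i l * PX l j)
    (hPY0 : ∀ i j, PnY 0 i j = if i = j then 1 else 0) (hPYs : ∀ n i j, PnY (n + 1) i j = ∑ l ∈ range m, PnY n i l * PY l j)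
    (hTX : ∀ n j, TX n j = (1 - βX j ^ n) / RX m + ∑ k ∈ Ico (j + 1) m, (1 / RX k - 1 / RX (k + 1)) * (βX k ^ n - βX j ^ n))
    (hTY : ∀ n j, TY n j = (1 - βY j ^ n) / RY m + ∑ k ∈ Ico (j + 1) m, (1 / RY k - 1 / RY (k + 1)) * (βY k ^ n - βY j ^ n))
    (hc : 0 ≤ c) (hcK : c * M 0 = 1 + c) (hN0 : N 0 = 1) (hN1 : N 1 = 1) (hm : 1 < m) {n : ℕ} (hn : Odd n) :
    PnY (n + 1) 0 0 - PnX (n + 1) 0 0 ≤ 0 := by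
  obtain ⟨g, hg⟩ : ∃ g : ℕ → ℝ → ℝ, ∀ n t, g n t = (-t - (-t) ^ (n + 1)) / (1 + t) := ⟨_, fun _ _ => rfl⟩
  have h := above_deficit_le_g hρX hmonoX hρY hmonoY hagree htag hN hNge hRX hRY hM hPXoff hPXdiag hPYoff hPYdiag hfX hfY hβX hβY ha hPX0 hPXs hPY0 hPYs hTX hTY hg
    hc hcK hN0 hN1 hm n
  have htY : 0 ≤ ρX 0 / ρY 1 := div_nonneg (hρX 0).le (hρY 1).le
  have hle : ρX 0 / ρY 1 ≤ ρX 0 / ρX 1 := div_le_div_of_nonneg_left (hρX 0).le (hρX 1) htag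
  have hanti := residual_g_odd_anti hg hn htY hle
  have : c ^ (n + 1) * (g n (ρX 0 / ρX 1) - g n (ρX 0 / ρY 1)) ≤ 0 := mul_nonpos_of_nonneg_of_nonpos (pow_nonneg hc _) (by linarith)
  linarith

/-- **AT ODD STEPS (`n` even): `e_{n+1} ≤ c^{n+1}·t_Y/(1+t_Y)`, `t_Y = ρ_0/ρ^Y_1`** (for the star `K^{−(n+1)}·W_b/(W_z + W_b)`). [ours] -/
theorem above_deficit_odd_step (hρX : ∀ i, 0 < ρX i) (hmonoX : Monotone ρX) (hρY : ∀ i, 0 < ρY i) (hmonoY : Monotone ρY)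
    (hagree : ∀ i, i ≠ 1 → ρX i = ρY i) (htag : ρX 1 ≤ ρY 1) (hN : ∀ i, 0 < N i) (hNge : ∀ i, 1 ≤ N i)
    (hRX : ∀ k, RX k = ∑ i ∈ range k, N i * ρX i) (hRY : ∀ k, RY k = ∑ i ∈ range k, N i * ρY i) (hM : ∀ k, M k = ∑ i ∈ Ico k m, N i)
    (hPXoff : ∀ i j, i ≠ j → PX i j = c * N j * min 1 (ρX j / ρX i)) (hPXdiag : ∀ i, PX i i = 1 - ∑ j ∈ (range m).erase i, PX i j)
    (hPYoff : ∀ i j, i ≠ j → PY i j = c * N j * min 1 (ρY j / ρY i)) (hPYdiag : ∀ i, PY i i = 1 - ∑ j ∈ (range m).erase i, PY i j)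
    (hfX : ∀ k i, fX k i = if i < k then ρX k else if i = k then -(RX k / N k) else 0)
    (hfY : ∀ k i, fY k i = if i < k then ρY k else if i = k then -(RY k / N k) else 0)
    (hβX : ∀ k, βX k = 1 - c * (M k + RX k / ρX k)) (hβY : ∀ k, βY k = 1 - c * (M k + RY k / ρY k)) (ha : ∀ l, a l = 1 - c * M (l + 1))
    (hPX0 : ∀ i j, PnX 0 i j = if i = j then 1 else 0) (hPXs : ∀ n i j, PnX (n + 1) i j = ∑ l ∈ range m, PnX n i l * PX l j)
    (hPY0 : ∀ i j, PnY 0 i j = if i = j then 1 else 0) (hPYs : ∀ n i j, PnY (n + 1) i j = ∑ l ∈ range m, PnY n i l * PY l j)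
    (hTX : ∀ n j, TX n j = (1 - βX j ^ n) / RX m + ∑ k ∈ Ico (j + 1) m, (1 / RX k - 1 / RX (k + 1)) * (βX k ^ n - βX j ^ n))
    (hTY : ∀ n j, TY n j = (1 - βY j ^ n) / RY m + ∑ k ∈ Ico (j + 1) m, (1 / RY k - 1 / RY (k + 1)) * (βY k ^ n - βY j ^ n))
    (hc : 0 ≤ c) (hcK : c * M 0 = 1 + c) (hN0 : N 0 = 1) (hN1 : N 1 = 1) (hm : 1 < m) {n : ℕ} (hn : Even n) :
    PnY (n + 1) 0 0 - PnX (n + 1) 0 0 ≤ c ^ (n + 1) * ((ρX 0 / ρY 1) / (1 + ρX 0 / ρY 1)) := by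
  obtain ⟨g, hg⟩ : ∃ g : ℕ → ℝ → ℝ, ∀ n t, g n t = (-t - (-t) ^ (n + 1)) / (1 + t) := ⟨_, fun _ _ => rfl⟩
  have h := above_deficit_le_g hρX hmonoX hρY hmonoY hagree htag hN hNge hRX hRY hM hPXoff hPXdiag hPYoff hPYdiag hfX hfY hβX hβY ha hPX0 hPXs hPY0 hPYs hTX hTY hg
    hc hcK hN0 hN1 hm n
  have htY : 0 ≤ ρX 0 / ρY 1 := div_nonneg (hρX 0).le (hρY 1).le
  have htX1 : ρX 0 / ρX 1 ≤ 1 := by rw [div_le_one (hρX 1)]; exact hmonoX zero_le_one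
  have h1 := residual_g_even_le hg hn (div_nonneg (hρX 0).le (hρX 1).le) htX1
  have h2 := residual_g_even_ge hg hn htY
  have : c ^ (n + 1) * (g n (ρX 0 / ρX 1) - g n (ρX 0 / ρY 1)) ≤ c ^ (n + 1) * ((ρX 0 / ρY 1) / (1 + ρX 0 / ρY 1)) :=
    mul_le_mul_of_nonneg_left (by linarith) (pow_nonneg hc _)
  linarith

/-! ### The discounted form -/

/-- **THE DISCOUNTED DEFICIT FOR THE START CLASS ABOVE THE TAG:** `Σ_{n<J}(1−σ)σⁿ·max{0,e_{n+1}} ≤ (1−σ)·(t_Y/(1+t_Y))·c·(σc)²/(1−(σc)²)` (no deficit before the third attempt). [ours] -/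
theorem above_deficit_discounted (hρX : ∀ i, 0 < ρX i) (hmonoX : Monotone ρX) (hρY : ∀ i, 0 < ρY i) (hmonoY : Monotone ρY)
    (hagree : ∀ i, i ≠ 1 → ρX i = ρY i) (htag : ρX 1 ≤ ρY 1) (hN : ∀ i, 0 < N i) (hNge : ∀ i, 1 ≤ N i)
    (hRX : ∀ k, RX k = ∑ i ∈ range k, N i * ρX i) (hRY : ∀ k, RY k = ∑ i ∈ range k, N i * ρY i) (hM : ∀ k, M k = ∑ i ∈ Ico k m, N i)
    (hPXoff : ∀ i j, i ≠ j → PX i j = c * N j * min 1 (ρX j / ρX i)) (hPXdiag : ∀ i, PX i i = 1 - ∑ j ∈ (range m).erase i, PX i j)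
    (hPYoff : ∀ i j, i ≠ j → PY i j = c * N j * min 1 (ρY j / ρY i)) (hPYdiag : ∀ i, PY i i = 1 - ∑ j ∈ (range m).erase i, PY i j)
    (hfX : ∀ k i, fX k i = if i < k then ρX k else if i = k then -(RX k / N k) else 0)
    (hfY : ∀ k i, fY k i = if i < k then ρY k else if i = k then -(RY k / N k) else 0)
    (hβX : ∀ k, βX k = 1 - c * (M k + RX k / ρX k)) (hβY : ∀ k, βY k = 1 - c * (M k + RY k / ρY k)) (ha : ∀ l, a l = 1 - c * M (l + 1))
    (hPX0 : ∀ i j, PnX 0 i j = if i = j then 1 else 0) (hPXs : ∀ n i j, PnX (n + 1) i j = ∑ l ∈ range m, PnX n i l * PX l j)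
    (hPY0 : ∀ i j, PnY 0 i j = if i = j then 1 else 0) (hPYs : ∀ n i j, PnY (n + 1) i j = ∑ l ∈ range m, PnY n i l * PY l j)
    (hTX : ∀ n j, TX n j = (1 - βX j ^ n) / RX m + ∑ k ∈ Ico (j + 1) m, (1 / RX k - 1 / RX (k + 1)) * (βX k ^ n - βX j ^ n))
    (hTY : ∀ n j, TY n j = (1 - βY j ^ n) / RY m + ∑ k ∈ Ico (j + 1) m, (1 / RY k - 1 / RY (k + 1)) * (βY k ^ n - βY j ^ n))
    (hc : 0 ≤ c) (hc1 : c ≤ 1) (hcK : c * M 0 = 1 + c) (hN0 : N 0 = 1) (hN1 : N 1 = 1) (hm : 1 < m)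
    {σ : ℝ} (hσ0 : 0 ≤ σ) (hσ1 : σ < 1) (J : ℕ) :
    ∑ n ∈ range J, (1 - σ) * σ ^ n * max 0 (PnY (n + 1) 0 0 - PnX (n + 1) 0 0)
      ≤ (1 - σ) * ((ρX 0 / ρY 1) / (1 + ρX 0 / ρY 1) * c * ((σ * c) ^ 2 / (1 - (σ * c) ^ 2))) := by
  obtain ⟨g, hg⟩ : ∃ g : ℕ → ℝ → ℝ, ∀ n t, g n t = (-t - (-t) ^ (n + 1)) / (1 + t) := ⟨_, fun _ _ => rfl⟩
  set tY := ρX 0 / ρY 1 with htYdef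
  have htY0 : 0 ≤ tY := div_nonneg (hρX 0).le (hρY 1).le
  have htX0 : 0 ≤ ρX 0 / ρX 1 := div_nonneg (hρX 0).le (hρX 1).le
  have hA : 0 ≤ tY / (1 + tY) * c := mul_nonneg (div_nonneg htY0 (by linarith)) hc
  have hσc : σ * c < 1 := by nlinarith
  have hσc0 : 0 ≤ σ * c := mul_nonneg hσ0 hc
  have hterm : ∀ n, max 0 (PnY (n + 1) 0 0 - PnX (n + 1) 0 0) ≤ (if Even n ∧ n ≠ 0 then (tY / (1 + tY) * c) * c ^ n else 0) := by
    intro n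
    rcases Nat.even_or_odd n with he | ho
    · by_cases hn0 : n = 0
      · subst hn0
        rw [if_neg (by simp)]
        have h := above_deficit_le_g hρX hmonoX hρY hmonoY hagree htag hN hNge hRX hRY hM hPXoff hPXdiag hPYoff hPYdiag hfX hfY hβX hβY ha hPX0 hPXs hPY0 hPYs hTX hTY hg
          hc hcK hN0 hN1 hm 0
        rw [residual_g_zero hg htX0, residual_g_zero hg htY0, sub_self, mul_zero] at h
        exact max_le le_rfl h
      · rw [if_pos ⟨he, hn0⟩]
        have h := above_deficit_odd_step hρX hmonoX hρY hmonoY hagree htag hN hNge hRX hRY hM hPXoff hPXdiag hPYoff hPYdiag hfX hfY hβX hβY ha hPX0 hPXs hPY0 hPYs hTX hTY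
          hc hcK hN0 hN1 hm he
        refine max_le (mul_nonneg hA (pow_nonneg hc n)) ?_
        calc PnY (n + 1) 0 0 - PnX (n + 1) 0 0 ≤ c ^ (n + 1) * (tY / (1 + tY)) := h
          _ = tY / (1 + tY) * c * c ^ n := by rw [pow_succ]; ring
    · rw [if_neg (fun h => (Nat.not_even_iff_odd.mpr ho) h.1)]
      exact max_le le_rfl (above_deficit_even_step hρX hmonoX hρY hmonoY hagree htag hN hNge hRX hRY hM hPXoff hPXdiag hPYoff hPYdiag hfX hfY hβX hβY ha hPX0 hPXs
        hPY0 hPYs hTX hTY hc hcK hN0 hN1 hm ho)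
  have hgeom : ∑ n ∈ range J, (if Even n ∧ n ≠ 0 then (σ * c) ^ n else 0) ≤ (σ * c) ^ 2 / (1 - (σ * c) ^ 2) := by
    have h1 : 0 < 1 - (σ * c) ^ 2 := by nlinarith
    rcases Nat.eq_zero_or_pos J with hJ | hJ
    · subst hJ; rw [sum_range_zero]; exact div_nonneg (pow_nonneg hσc0 2) h1.le
    · have hsplit : ∑ n ∈ range J, (if Even n then (σ * c) ^ n else 0) = 1 + ∑ n ∈ range J, (if Even n ∧ n ≠ 0 then (σ * c) ^ n else 0) := by
        have hpt : ∀ n, (if Even n then (σ * c) ^ n else (0:ℝ)) = (if Even n ∧ n ≠ 0 then (σ * c) ^ n else 0) + (if n = 0 then (1:ℝ) else 0) := by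
          intro n; by_cases h0 : n = 0
          · subst h0; simp
          · simp [h0]
        rw [sum_congr rfl fun n _ => hpt n, sum_add_distrib, sum_ite_eq' (range J) 0, if_pos (mem_range.mpr hJ)]; ring
      have hle := budget_evenGeom_le hσc0 hσc J
      rw [hsplit] at hle
      have h2 := (le_div_iff₀ h1).mp hle
      rw [le_div_iff₀ h1]
      have h3 : (∑ n ∈ range J, (if Even n ∧ n ≠ 0 then (σ * c) ^ n else (0:ℝ))) * (1 - (σ * c) ^ 2)
          = (1 + ∑ n ∈ range J, (if Even n ∧ n ≠ 0 then (σ * c) ^ n else (0:ℝ))) * (1 - (σ * c) ^ 2) - (1 - (σ * c) ^ 2) := by ring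
      rw [h3]; linarith
  have hsum : ∑ n ∈ range J, σ ^ n * (if Even n ∧ n ≠ 0 then (tY / (1 + tY) * c) * c ^ n else 0) ≤ tY / (1 + tY) * c * ((σ * c) ^ 2 / (1 - (σ * c) ^ 2)) := by
    have e : ∑ n ∈ range J, σ ^ n * (if Even n ∧ n ≠ 0 then (tY / (1 + tY) * c) * c ^ n else 0)
        = tY / (1 + tY) * c * ∑ n ∈ range J, (if Even n ∧ n ≠ 0 then (σ * c) ^ n else 0) := by
      rw [mul_sum]
      refine sum_congr rfl fun n _ => ?_
      split_ifs
      · rw [mul_pow]; ring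
      · ring
    rw [e]
    exact mul_le_mul_of_nonneg_left hgeom hA
  calc ∑ n ∈ range J, (1 - σ) * σ ^ n * max 0 (PnY (n + 1) 0 0 - PnX (n + 1) 0 0)
      ≤ ∑ n ∈ range J, (1 - σ) * (σ ^ n * (if Even n ∧ n ≠ 0 then (tY / (1 + tY) * c) * c ^ n else 0)) := by
        refine sum_le_sum fun n _ => ?_
        rw [mul_assoc]
        exact mul_le_mul_of_nonneg_left (mul_le_mul_of_nonneg_left (hterm n) (pow_nonneg hσ0 n)) (by linarith)
    _ = (1 - σ) * ∑ n ∈ range J, σ ^ n * (if Even n ∧ n ≠ 0 then (tY / (1 + tY) * c) * c ^ n else 0) := by rw [mul_sum]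
    _ ≤ (1 - σ) * (tY / (1 + tY) * c * ((σ * c) ^ 2 / (1 - (σ * c) ^ 2))) := mul_le_mul_of_nonneg_left hsum (by linarith)

end Above

end Summit.Ventures.LatticeQCDFlow.Scaling
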